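import Summits.HodgeConjecture.CorCM.OcticWeilMultiSixfoldSubproduct
import Summits.HodgeConjecture.CorCM.CMWeightPullbackSubproduct
import HarnessLib

/-!
# COR-CM — any number `r` of CM types over one octic CM field: the Weil SIXFOLD parts (TWO curve points + the four labels of a
# `(1,3)`-slot `B_m` of one sign) of the weights of every product of copies of `E, B₁, …, B_r` have algebraic lines, GIVEN the Weil
# plane of `(B_m × E) × E`

Cell `pub-hodgecm2` (COR-CM), seat b30 gen 25 (2026-08-23); count-neutral own lane OCTIC-MULTI (geometry half); sequel of
`CorCM/OcticWeilMultiSixfoldSubproduct.lean` (`consSlot`, `foldO`, the six-point weights of `B_m ⊞ E ⊞ E`).  Theorems only; no definition,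
no named fact, no `sorry`: the Weil plane of `((B_m × E) × E, (ι(iδ) × ι(δ)) × ι(δ))` enters as the HYPOTHESIS `hW₃`.  The slot-generic
twin of §3–§4 of gen 20's `CorCM/OcticWeilMixedSixfoldParts.lean` (same proofs; gen 18's RE-SLOTTING device one level up: the model map is
NOT injective on a sixfold part — two curve points — so the second curve copy is moved to the fresh slot of `Y⁺ = E ⊞ Y` before projecting).

* §1 `weightClassesAlg_le_algebraicClasses_of_isSixPartO_cons` — a sixfold part of a weight of `⨁_j A(consSlot r (κ' j))` on which the
  projection to `Y⁺` is injective with slots in the range of `foldO m`: pull its image back to the sub-product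
  (`CMWeights.weightClassesAlg_map_le_algebraicClasses`) and lift along `κ'` (distribution lemma
  `CMWeights.weightClassesAlg_comp_le_algebraicClasses_of_injOn`).
* §2 `…_of_factor` and **`weightClassesAlg_le_algebraicClasses_of_isSixPartO`** — ANY slot map `κ : Fin N → Fin (r+1)`: re-slot the second
  curve copy of the part to the fresh slot `0` of `Y⁺` (`κ = consSlot r ∘ κ'`), which separates the two curve points.
HONEST FRAMING: nothing about the Hodge conjecture is concluded here; `HC_CM` is not asserted.
[cite: Deligne1982HodgeCycles, §5 (c)] [cite: Milne2020HodgeClassesAV, 1.2 (a) and Thm. 1] [cite: MoonenZarhin1995Duke, Thm. 2.4]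

## References
* [Deligne1982HodgeCycles] P. Deligne, LNM 900 (1982), §5 (c).  [Milne2020HodgeClassesAV] J. S. Milne, arXiv:2010.08857, 1.2 (a),
  Thm. 1.  [MoonenZarhin1995Duke] B. Moonen, Yu. Zarhin, Duke Math. J. 77 (1995), Thm. 2.4.
-/

noncomputable section

open CategoryTheory CategoryTheory.Limits NumberField

namespace Summit.HodgeConjecture.CorCM.OcticWeilMulti

open Literature.AlgebraicGeometry Literature.AlgebraicGeometry.Motives Literature.AlgebraicGeometry.HodgeTheory
open Literature.AlgebraicGeometry.ComplexMultiplication (IsCMTypeRealisation)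
open Literature.AlgebraicGeometry.Pohlmann1968
open Literature.AlgebraicTopology.SingularHomology
open Literature.NumberTheory.ComplexMultiplication
open Summit.HodgeConjecture.CorCM.Census.OcticWeilMulti (PtO IsSixPartO)
open Summit.HodgeConjecture.CorCM.DecicWeil23Multi (multiSlots sigma_casesM)
open Summit.HodgeConjecture.CorCM.CMWeights (weightClassesAlg_comp_le_algebraicClasses_of_injOn
  weightClassesAlg_map_le_algebraicClasses sigma_map_injective)
open Summit.HodgeConjecture.CorCM.PairWeights

open scoped Classical

section Sixfold

variable {I : Type} {r : ℕ} {Kf : I → Type} [∀ i, Field (Kf i)] [∀ i, NumberField (Kf i)]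
  {i₀ i₁ : I} {e : (Kf i₁ →+* ℂ) ≃ Fin 4 × Bool} {τ : Kf i₀ →+* ℂ} {i : Kf i₀ →+* Kf i₁}
  (hk : ∀ σ : Kf i₀ →+* ℂ, σ = τ ∨ σ = ComplexEmbedding.conjugate τ)
  (he_sign : ∀ s : Kf i₁ →+* ℂ, (e s).2 = true ↔ s.comp i = τ)
  {A : Fin (r + 1) → AbelianVariety ℂ} {Φ : ∀ j : Fin (r + 1), CMType (Kf (multiSlots r i₀ i₁ j))}
  {ι : ∀ j, 𝓞 (Kf (multiSlots r i₀ i₁ j)) →+* End (A j)}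
  {θ : ∀ j, Kf (multiSlots r i₀ i₁ j) →+* Module.End ℂ (complexBetti (A j).X 1)}
  (hA : ∀ j, IsCMTypeRealisation (Φ j) (A j) (ι j) (θ j))
  {δ : 𝓞 (Kf i₀)} {d : ℕ} (hτ : τ (δ : Kf i₀) = Complex.I * (Real.sqrt d : ℂ))

/-! ## §1 Sixfold parts of `⨁_j A(consSlot r (κ' j))` with injective projection to `Y⁺` -/

include hk he_sign hA hτ in
/-- **Re-slotted form.**  For `κ' : Fin N → Fin (r+2)`, a sixfold part `G` of slot `m` of a weight of `X = ⨁_j A(consSlot r (κ' j))` on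
which the projection `P' (j, s) = (κ' j, s)` to `Y⁺` is injective and takes slots in `{m+2, 1, 0}` has an algebraic line: `P'(G)` is the
image under `foldO m` of a six-point weight of `B_m ⊞ E ⊞ E` of constant sign (§2), pulled back to `Y⁺`
(`CMWeights.weightClassesAlg_map_le_algebraicClasses`) and lifted along `κ'` (distribution lemma).
[cite: Milne2020HodgeClassesAV, 1.2 (a) and Thm. 1] -/
theorem weightClassesAlg_le_algebraicClasses_of_isSixPartO_cons (m : Fin r)
    (hW₃ : weilClassesOf (((A m.succ).prod (A 0)).prod (A 0))
      (AbelianVariety.prodLift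
        (AbelianVariety.fst ((A m.succ).prod (A 0)) (A 0) ≫
          AbelianVariety.prodLift (AbelianVariety.fst (A m.succ) (A 0) ≫ ι m.succ (RingOfIntegers.mapRingHom i δ))
            (AbelianVariety.snd (A m.succ) (A 0) ≫ ι 0 δ))
        (AbelianVariety.snd ((A m.succ).prod (A 0)) (A 0) ≫ ι 0 δ)) 3 d ≤
      algebraicClasses (((A m.succ).prod (A 0)).prod (A 0)).X 3)
    {N : ℕ} (κ' : Fin N → Fin (r + 2)) {b : Bool} {G : Finset ((j : Fin N) × (Kf (multiSlots r i₀ i₁ (consSlot r (κ' j))) →+* ℂ))}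
    (hG : IsSixPartO (fun x => toPtO e τ ⟨consSlot r (κ' x.1), x.2⟩) m b G)
    (hinj : Set.InjOn (Sigma.map κ' (fun _ => id) :
      ((j : Fin N) × (Kf (multiSlots r i₀ i₁ (consSlot r (κ' j))) →+* ℂ)) →
        ((l : Fin (r + 2)) × (Kf (multiSlots r i₀ i₁ (consSlot r l)) →+* ℂ))) ↑G)
    (hrange : ∀ x ∈ G, κ' x.1 ∈ Set.range (foldO m)) :
    weightClassesAlg (fun j => A (consSlot r (κ' j))) (fun j => ι (consSlot r (κ' j))) (2 * 3) G ≤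
      algebraicClasses (⨁ fun j => A (consSlot r (κ' j))).X 3 := by
  set P' : ((j : Fin N) × (Kf (multiSlots r i₀ i₁ (consSlot r (κ' j))) →+* ℂ)) →
      ((l : Fin (r + 2)) × (Kf (multiSlots r i₀ i₁ (consSlot r l)) →+* ℂ)) := Sigma.map κ' (fun _ => id) with hP'
  set T' := G.image P' with hT'
  have hT'card : T'.card = 2 * 3 := by rw [hT', Finset.card_image_of_injOn hinj, hG.1]
  -- the sub-product weight
  set F₃ : ((l : Fin 3) × (Kf (multiSlots r i₀ i₁ (consSlot r (foldO m l))) →+* ℂ)) →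
      ((l : Fin (r + 2)) × (Kf (multiSlots r i₀ i₁ (consSlot r l)) →+* ℂ)) := fun z => ⟨foldO m z.1, z.2⟩ with hF₃
  have hF₃inj : Function.Injective F₃ :=
    sigma_map_injective (K := fun l => Kf (multiSlots r i₀ i₁ (consSlot r l))) (foldO m) (foldO_injective m)
  set T₃ := T'.preimage F₃ hF₃inj.injOn with hT₃
  have hT₃map : T₃.map ⟨F₃, hF₃inj⟩ = T' := by
    rw [Finset.map_eq_image, hT₃]
    change (T'.preimage F₃ hF₃inj.injOn).image F₃ = T'
    rw [Finset.image_preimage]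
    have key : ∀ y : (l : Fin (r + 2)) × (Kf (multiSlots r i₀ i₁ (consSlot r l)) →+* ℂ), y.1 ∈ Set.range (foldO m) →
        y ∈ Set.range F₃ := by
      rintro ⟨l, t⟩ ⟨l₃, rfl⟩
      exact ⟨⟨l₃, t⟩, rfl⟩
    refine Finset.filter_true_of_mem fun y hy => ?_
    obtain ⟨x, hx, rfl⟩ := Finset.mem_image.1 hy
    exact key (P' x) (hrange x hx)
  have hT₃card : T₃.card = 2 * 3 := by rw [← hT'card, ← hT₃map, Finset.card_map]
  have hsgn : ∀ z ∈ T₃, toPtO e τ ⟨consSlot r (foldO m z.1), z.2⟩ = Sum.inl b ∨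
      ∃ (m' : Fin r) (a : Fin 4), toPtO e τ ⟨consSlot r (foldO m z.1), z.2⟩ = Sum.inr (m', (a, b)) := by
    intro z hz
    have hz' : F₃ z ∈ T' := Finset.mem_preimage.1 hz
    obtain ⟨x, hx, hxz⟩ := Finset.mem_image.1 hz'
    have hv : toPtO e τ ⟨consSlot r (κ' x.1), x.2⟩ = toPtO e τ ⟨consSlot r (foldO m z.1), z.2⟩ :=
      congrArg (fun w : (l : Fin (r + 2)) × (Kf (multiSlots r i₀ i₁ (consSlot r l)) →+* ℂ) =>
        toPtO e τ (⟨consSlot r w.1, w.2⟩ : (l : Fin (r + 1)) × (Kf (multiSlots r i₀ i₁ l) →+* ℂ))) hxz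
    rw [← hv]
    rcases hG.mem_cases hx with h | ⟨a, h⟩
    · exact Or.inl h
    · exact Or.inr ⟨m, a, h⟩
  have halg₃ := weightClassesAlg_three_le_algebraicClasses_of_signO hk he_sign hτ m hW₃ b T₃ hT₃card hsgn
  -- pull back to `Y⁺` and lift along `κ'`
  have hA' : ∀ l : Fin (r + 2), IsCMTypeRealisation (Φ (consSlot r l)) (A (consSlot r l)) (ι (consSlot r l)) (θ (consSlot r l)) :=
    fun l => hA (consSlot r l)
  have hY' := weightClassesAlg_map_le_algebraicClasses (K := fun l => Kf (multiSlots r i₀ i₁ (consSlot r l)))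
    (A := fun l => A (consSlot r l)) (Φ := fun l => Φ (consSlot r l)) (ι := fun l => ι (consSlot r l)) (θ := fun l => θ (consSlot r l))
    hA' (foldO m) (foldO_injective m) hT₃card halg₃
  rw [hT₃map] at hY'
  exact weightClassesAlg_comp_le_algebraicClasses_of_injOn (K := fun l => Kf (multiSlots r i₀ i₁ (consSlot r l)))
    (A := fun l => A (consSlot r l)) (Φ := fun l => Φ (consSlot r l)) (ι := fun l => ι (consSlot r l)) (θ := fun l => θ (consSlot r l))
    hA' κ' hG.1 hinj hY'

/-! ## §2 Any slot map: re-slot the second curve copy -/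

include hk he_sign hA hτ in
/-- **Re-slotting.**  For `κ : Fin N → Fin (r+1)` FACTORED as `κ = consSlot r ∘ κ'` (so that `X = ⨁_j A(κ j)` is LITERALLY
`⨁_j A(consSlot r (κ' j))`), a sixfold part `G` of slot `m` of a weight of `X` whose two curve points are SEPARATED by `κ'` and whose
slots under `κ'` lie in `{m+2, 1, 0}` has an algebraic line (§3; injectivity of the projection from `IsSixPartO.eq_of_inr`).
[cite: Milne2020HodgeClassesAV, 1.2 (a) and Thm. 1] -/
theorem weightClassesAlg_le_algebraicClasses_of_isSixPartO_of_factor (m : Fin r)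
    (hW₃ : weilClassesOf (((A m.succ).prod (A 0)).prod (A 0))
      (AbelianVariety.prodLift
        (AbelianVariety.fst ((A m.succ).prod (A 0)) (A 0) ≫
          AbelianVariety.prodLift (AbelianVariety.fst (A m.succ) (A 0) ≫ ι m.succ (RingOfIntegers.mapRingHom i δ))
            (AbelianVariety.snd (A m.succ) (A 0) ≫ ι 0 δ))
        (AbelianVariety.snd ((A m.succ).prod (A 0)) (A 0) ≫ ι 0 δ)) 3 d ≤
      algebraicClasses (((A m.succ).prod (A 0)).prod (A 0)).X 3)
    {N : ℕ} (κ : Fin N → Fin (r + 1)) (κ' : Fin N → Fin (r + 2)) (hκ : ∀ j, consSlot r (κ' j) = κ j)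
    {b : Bool} {G : Finset ((j : Fin N) × (Kf (multiSlots r i₀ i₁ (κ j)) →+* ℂ))}
    (hG : IsSixPartO (fun x => toPtO e τ ((Sigma.map κ (fun _ => id) :
      ((j : Fin N) × (Kf (multiSlots r i₀ i₁ (κ j)) →+* ℂ)) → ((l : Fin (r + 1)) × (Kf (multiSlots r i₀ i₁ l) →+* ℂ))) x)) m b G)
    (hsep : ∀ x ∈ G, ∀ x' ∈ G, toPtO e τ ⟨κ x.1, x.2⟩ = Sum.inl b → toPtO e τ ⟨κ x'.1, x'.2⟩ = Sum.inl b → x ≠ x' →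
      κ' x.1 ≠ κ' x'.1)
    (hrange : ∀ x ∈ G, κ' x.1 ∈ Set.range (foldO m)) :
    weightClassesAlg (fun j => A (κ j)) (fun j => ι (κ j)) (2 * 3) G ≤ algebraicClasses (⨁ fun j => A (κ j)).X 3 := by
  -- `X` is literally the re-slotted product
  obtain rfl : κ = fun j => consSlot r (κ' j) := funext fun j => (hκ j).symm
  refine weightClassesAlg_le_algebraicClasses_of_isSixPartO_cons hk he_sign hA hτ m hW₃ κ' hG ?_ hrange
  -- injectivity of the projection on `G`
  intro x hx x' hx' hxx'
  have hfst : κ' x.1 = κ' x'.1 := congrArg Sigma.fst hxx'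
  have hvv : toPtO e τ ⟨consSlot r (κ' x.1), x.2⟩ = toPtO e τ ⟨consSlot r (κ' x'.1), x'.2⟩ := by
    have h := congrArg (fun z : (l : Fin (r + 2)) × (Kf (multiSlots r i₀ i₁ (consSlot r l)) →+* ℂ) =>
      toPtO e τ (⟨consSlot r z.1, z.2⟩ : (l : Fin (r + 1)) × (Kf (multiSlots r i₀ i₁ l) →+* ℂ))) hxx'
    exact h
  by_contra hne
  rcases hy : toPtO e τ ⟨consSlot r (κ' x.1), x.2⟩ with c | q
  · have hc : c = b := by
      rcases hG.mem_cases hx with h | ⟨a, h⟩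
      · change toPtO e τ ⟨consSlot r (κ' x.1), x.2⟩ = _ at h; rw [hy] at h; exact Sum.inl.inj h
      · change toPtO e τ ⟨consSlot r (κ' x.1), x.2⟩ = _ at h; rw [hy] at h; exact absurd h Sum.inl_ne_inr
    subst hc
    rw [hy] at hvv
    exact hsep x hx x' hx' hy hvv.symm hne hfst
  · rw [hy] at hvv
    exact hne (hG.eq_of_inr hx hx' hy hvv.symm)

include hk he_sign hA hτ in
/-- **THE SIXFOLD PARTS HAVE ALGEBRAIC LINES (any slot map).**  For `κ : Fin N → Fin (r+1)` and a sixfold part `G` of a `(1,3)`-slot `m`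
(sign `b`) of a weight of `X = ⨁_j A(κ j)` — two curve points `x₁ ≠ x₂` over `inl b` (two different copies of `E`) and the four labels
`(m, a, b)` — `H⁶(X)_G ⊆ N³ H⁶(X)`, GIVEN the Weil plane of `(B_m × E) × E`.  Re-slot: `κ' j₂ = 0`, `κ' j = (κ j) + 1` otherwise
(`consSlot r ∘ κ' = κ`; `κ' j₁ = 1 ≠ 0` separates the curve points; the `B_m`-points keep slot `m + 2`), then the factored form.
[cite: Milne2020HodgeClassesAV, 1.2 (a) and Thm. 1] [cite: Deligne1982HodgeCycles, §5 (c)] -/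
theorem weightClassesAlg_le_algebraicClasses_of_isSixPartO {m : Fin r}
    (hW₃ : weilClassesOf (((A m.succ).prod (A 0)).prod (A 0))
      (AbelianVariety.prodLift
        (AbelianVariety.fst ((A m.succ).prod (A 0)) (A 0) ≫
          AbelianVariety.prodLift (AbelianVariety.fst (A m.succ) (A 0) ≫ ι m.succ (RingOfIntegers.mapRingHom i δ))
            (AbelianVariety.snd (A m.succ) (A 0) ≫ ι 0 δ))
        (AbelianVariety.snd ((A m.succ).prod (A 0)) (A 0) ≫ ι 0 δ)) 3 d ≤
      algebraicClasses (((A m.succ).prod (A 0)).prod (A 0)).X 3)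
    {N : ℕ} (κ : Fin N → Fin (r + 1)) {b : Bool} {G : Finset ((j : Fin N) × (Kf (multiSlots r i₀ i₁ (κ j)) →+* ℂ))}
    (hG : IsSixPartO (fun x => toPtO e τ ((Sigma.map κ (fun _ => id) :
      ((j : Fin N) × (Kf (multiSlots r i₀ i₁ (κ j)) →+* ℂ)) → ((l : Fin (r + 1)) × (Kf (multiSlots r i₀ i₁ l) →+* ℂ))) x)) m b G) :
    G.card = 2 * 3 ∧ weightClassesAlg (fun j => A (κ j)) (fun j => ι (κ j)) (2 * 3) G ≤
      algebraicClasses (⨁ fun j => A (κ j)).X 3 := by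
  refine ⟨hG.1, ?_⟩
  -- the two curve points, in two different copies
  obtain ⟨x₁, hx₁, x₂, hx₂, hne, hv₁, hv₂⟩ := hG.exists_pair
  obtain ⟨σ₁, hσ₁, hσ₁'⟩ := fst_eq_zero_of_toPtO_eq_inl hk (x := ⟨κ x₁.1, x₁.2⟩) hv₁
  obtain ⟨σ₂, hσ₂, hσ₂'⟩ := fst_eq_zero_of_toPtO_eq_inl hk (x := ⟨κ x₂.1, x₂.2⟩) hv₂
  have hκ₁ : κ x₁.1 = 0 := congrArg Sigma.fst hσ₁
  have hκ₂ : κ x₂.1 = 0 := congrArg Sigma.fst hσ₂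
  have hj : x₁.1 ≠ x₂.1 := by
    intro hj
    apply hne
    have h1 : (⟨κ x₁.1, x₁.2⟩ : (l : Fin (r + 1)) × (Kf (multiSlots r i₀ i₁ l) →+* ℂ)) = ⟨κ x₂.1, x₂.2⟩ := by
      rw [hσ₁, hσ₂, hσ₁', hσ₂']
    obtain ⟨j₁, s₁⟩ := x₁
    obtain ⟨j₂, s₂⟩ := x₂
    change j₁ = j₂ at hj
    subst hj
    simp only [Sigma.mk.injEq, heq_eq_eq, true_and] at h1 ⊢
    exact h1
  -- the curve points of `G` are exactly `x₁`, `x₂`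
  have hmem : ∀ y ∈ G, toPtO e τ ⟨κ y.1, y.2⟩ = Sum.inl b → y = x₁ ∨ y = x₂ := by
    intro y hy' hyv
    obtain ⟨z₁, z₂, -, h12⟩ := Finset.card_eq_two.1 hG.2.1
    have hall : ∀ y ∈ G, toPtO e τ ⟨κ y.1, y.2⟩ = Sum.inl b → y = z₁ ∨ y = z₂ := by
      intro y hy'' hyv'
      have : y ∈ G.filter fun x => toPtO e τ ((Sigma.map κ (fun _ => id) :
          ((j : Fin N) × (Kf (multiSlots r i₀ i₁ (κ j)) →+* ℂ)) → ((l : Fin (r + 1)) × (Kf (multiSlots r i₀ i₁ l) →+* ℂ))) x) =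
            Sum.inl b := Finset.mem_filter.2 ⟨hy'', hyv'⟩
      rw [h12, Finset.mem_insert, Finset.mem_singleton] at this
      exact this
    rcases hall x₁ hx₁ hv₁ with h₁ | h₁ <;> rcases hall x₂ hx₂ hv₂ with h₂ | h₂
    · exact absurd (h₁.trans h₂.symm) hne
    · rcases hall y hy' hyv with h | h
      · exact Or.inl (h.trans h₁.symm)
      · exact Or.inr (h.trans h₂.symm)
    · rcases hall y hy' hyv with h | h
      · exact Or.inr (h.trans h₂.symm)
      · exact Or.inl (h.trans h₁.symm)
    · exact absurd (h₁.trans h₂.symm) hne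
  -- the re-slotting `κ'`
  let κ' : Fin N → Fin (r + 2) := fun j => if j = x₂.1 then 0 else (κ j).succ
  have hκ' : ∀ j, consSlot r (κ' j) = κ j := by
    intro j
    by_cases h : j = x₂.1
    · simp only [κ', if_pos h]; rw [h, hκ₂]; rfl
    · simp only [κ', if_neg h]; rfl
  have hκ'₂ : κ' x₂.1 = 0 := by simp only [κ', if_pos rfl]
  have hκ'₁ : κ' x₁.1 = (0 : Fin (r + 1)).succ := by simp only [κ', if_neg hj]; rw [hκ₁]
  refine weightClassesAlg_le_algebraicClasses_of_isSixPartO_of_factor hk he_sign hA hτ m hW₃ κ κ' hκ' hG ?_ ?_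
  · -- separation of the curve points
    intro x hx x' hx' hxv hx'v hxx' hfst
    rcases hmem x hx hxv with rfl | rfl <;> rcases hmem x' hx' hx'v with rfl | rfl
    · exact hxx' rfl
    · rw [hκ'₁, hκ'₂] at hfst; exact absurd hfst (Fin.succ_ne_zero _)
    · rw [hκ'₁, hκ'₂] at hfst; exact absurd hfst.symm (Fin.succ_ne_zero _)
    · exact hxx' rfl
  · -- slots in `{m+2, 1, 0}`
    intro x hx
    refine mem_range_foldO ?_
    rcases hG.mem_cases hx with h | ⟨a, h⟩
    · rcases hmem x hx h with rfl | rfl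
      · exact Or.inr (Or.inl hκ'₁)
      · exact Or.inr (Or.inr hκ'₂)
    · -- a `B_m` point: slot `m+1`, in a copy different from `x₂`
      change toPtO e τ ⟨κ x.1, x.2⟩ = _ at h
      have hxm : κ x.1 = m.succ := by
        rcases sigma_casesM (⟨κ x.1, x.2⟩ : (l : Fin (r + 1)) × (Kf (multiSlots r i₀ i₁ l) →+* ℂ)) with ⟨σ, hσ⟩ | ⟨m', s, hs⟩
        · rw [hσ, toPtO_zero] at h; exact absurd h Sum.inl_ne_inr
        · rw [hs, toPtO_succ, Sum.inr.injEq, Prod.mk.injEq] at h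
          have hm : m' = m := h.1
          have h1 := congrArg Sigma.fst hs
          change κ x.1 = m'.succ at h1
          rw [h1, hm]
      have hne₂ : x.1 ≠ x₂.1 := by
        intro hh
        rw [hh, hκ₂] at hxm
        exact absurd hxm.symm (Fin.succ_ne_zero m)
      left
      show κ' x.1 = m.succ.succ
      simp only [κ', if_neg hne₂, hxm]

end Sixfold

end Summit.HodgeConjecture.CorCM.OcticWeilMulti

end
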